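import Summits.ResolutionOfSingularities.ResolutionOfSingularities.Theorems.FrobeniusLadderFInjectiveMacaulayficationX2YGBlowupRegularLocal
import Summits.ResolutionOfSingularities.ResolutionOfSingularities.Theorems.FrobeniusLadderFInjectiveMacaulayficationX2Cubic4FloorTwoCharts
import HarnessLib

/-!
# T-side CLASS ROUTE, chart level: a chart `X₄² + X_a·W` of the point floor of a double point `x² + F₃`, with `W` (the dehomogenised tangent-cone cubic, or ANY polynomial in the
# three remaining variables) PRIME with SMOOTH zero locus ⇒ the blowing up along `(X₄, X_a, W)` is REGULAR, `Sing = V(X₄, X_a, W)`, the centre is prime — bed-free, characteristic-free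
# (crux `FInjectiveMacaulayfication` stmt-ResolutionOfSingularities-15315, chain w45a; generalises res-L1-w45a-lead-1 g11's `X2Cubic4FloorTwoYChart`/`…Charts` (Fermat `W = 1 + Σ X_j³`) over the
# pointwise package ✓p679951 `X2YGBlowupRegularLocal`; seat res-L1-w45a-lead-1 g11)

[OURS · L1 W4.5a] Support file (`--supports stmt-ResolutionOfSingularities-15315 --as helper`); def-free; UNCONDITIONAL; no named fact; NOT a statement of any manuscript. AI-written
(AI review is weaker than expert review).

* §1 `exists_ringEquiv_fin5_of_perm` — for ANY splitting `π : Fin 5 ≃ Fin 2 ⊕ Fin 3` and ring iso `ι : k[Y₀,Y₁,Y₂] ≃+* Λ`: `ε : k[X₀..X₄] ≃+* Λ[T₀,T₁]` with `X_j ↦ T_i` (`π j = inl i`) resp.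
  `↦ C(ι Y_i)` (`π j = inr i`); `apply_rename_eq_C` — `ε (rename e w) = C (ι w)` whenever `π ∘ e = inr`.
* §2 `exists_quotientEquiv_chart` — the quotient bridge `k[X]/(X₄² + X_a·rename e w) ≃+* Λ[T]/(T₀² + T₁·C(ι w))` matching the centres `(X₄, X_a, rename e w) ↦ (T₀, T₁, C(ι w))`.
* §3 ★★ `chart_package` — for `w ∈ k[Y₀,Y₁,Y₂]` PRIME with `∀` prime `Q ∋ w` `∃` derivation `D`, `D w ∉ Q` (smooth zero locus, Stacks 07PF), chart `C_a = k[X]/(G)`, `G = X₄² + X_a·rename e w`,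
  centre `J = (X₄, X_a, rename e w)·C_a`: the chart rings `C_a[J/x̄_a]`, `C_a[J/w̄]` are regular ∧ `Sing(Spec C_a) = V(J)` ∧ `J` prime ∧ `x̄₄² = −x̄_a·w̄`;
  ★★ `isRegular_affineBlowup_chart` — `Bl_J Spec C_a` IS A REGULAR SCHEME. ANY field, ANY characteristic, ANY `a ≠ 4`, any splitting `π` with `π 4 = inl 0`, `π a = inl 1`, `π ∘ e = inr`.
[folklore; cite: Liu2002, Thm. 8.1.19 (a); StacksProject, Tag 07PF, Tag 0BIQ; GortzWedhorn2020, Prop. 13.96 (2), Prop. 13.91 (4)]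
-/

-- single-problem summit: the doubled namespace component is forced
set_option linter.dupNamespace false

noncomputable section

namespace Summit.ResolutionOfSingularities.ResolutionOfSingularities.Theorems.FInjectiveMacaulayfication.X2CubicFormChart

open MvPolynomial Literature.AlgebraicGeometry.Resolution AlgebraicGeometry
open Summit.ResolutionOfSingularities.ResolutionOfSingularities.Theorems.FInjectiveMacaulayfication

/-! ## §1 The coordinate bridge for an arbitrary splitting of the five variables -/

/-- **`k[X₀, …, X₄] ≃+* Λ[T₀, T₁]` along a splitting `π : Fin 5 ≃ Fin 2 ⊕ Fin 3`** and a ring iso `ι : k[Y₀,Y₁,Y₂] ≃+* Λ`: `X_j ↦ T_i` if `π j = inl i`, `X_j ↦ C(ι Y_i)` if `π j = inr i`,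
`c ↦ C(ι c)` (Mathlib `renameEquiv π`, `sumAlgEquiv`, `mapEquiv`). [folklore] -/
theorem exists_ringEquiv_fin5_of_perm (k : Type) [Field k] {Λ : Type} [CommRing Λ] (ι : MvPolynomial (Fin 3) k ≃+* Λ) (π : Fin 5 ≃ Fin 2 ⊕ Fin 3) :
    ∃ ε : MvPolynomial (Fin 5) k ≃+* MvPolynomial (Fin 2) Λ,
      (∀ j : Fin 5, ε (X j) = Sum.elim (fun i : Fin 2 => (X i : MvPolynomial (Fin 2) Λ)) (fun i : Fin 3 => C (ι (X i))) (π j)) ∧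
        ∀ c : k, ε (C c) = C (ι (C c)) := by
  let ε₀ : MvPolynomial (Fin 5) k ≃+* MvPolynomial (Fin 2) (MvPolynomial (Fin 3) k) := ((renameEquiv k π).trans (sumAlgEquiv k (Fin 2) (Fin 3))).toRingEquiv
  have hX : ∀ j : Fin 5, ε₀ (X j) = sumAlgEquiv k (Fin 2) (Fin 3) (X (π j)) := by
    intro j
    change sumAlgEquiv k (Fin 2) (Fin 3) (renameEquiv k _ (X j)) = _
    rw [renameEquiv_apply, rename_X]
  have hC : ∀ c : k, ε₀ (C c) = C (C c) := fun c => by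
    change sumAlgEquiv k (Fin 2) (Fin 3) (renameEquiv k _ (C c)) = _
    rw [renameEquiv_apply, rename_C, sumAlgEquiv_C_inl]
  let ε := ε₀.trans (mapEquiv (Fin 2) ι)
  have hε : ∀ x, ε x = MvPolynomial.map (ι : MvPolynomial (Fin 3) k →+* Λ) (ε₀ x) := fun x => rfl
  refine ⟨ε, fun j => ?_, fun c => ?_⟩
  · rw [hε, hX]
    rcases hπ : π j with i | i
    · rw [sumAlgEquiv_X_inl, map_X]; rfl
    · rw [sumAlgEquiv_X_inr, map_C]; rfl
  · rw [hε, hC, map_C]; rfl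

/-- **`ε (rename e w) = C (ι w)`** when the embedding `e : Fin 3 → Fin 5` is the `inr`-part of the splitting (`π (e i) = inr i`). [folklore] -/
theorem apply_rename_eq_C (k : Type) [Field k] {Λ : Type} [CommRing Λ] (ι : MvPolynomial (Fin 3) k ≃+* Λ) (π : Fin 5 ≃ Fin 2 ⊕ Fin 3)
    (ε : MvPolynomial (Fin 5) k ≃+* MvPolynomial (Fin 2) Λ)
    (hεX : ∀ j : Fin 5, ε (X j) = Sum.elim (fun i : Fin 2 => (X i : MvPolynomial (Fin 2) Λ)) (fun i : Fin 3 => C (ι (X i))) (π j))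
    (hεC : ∀ c : k, ε (C c) = C (ι (C c))) (e : Fin 3 → Fin 5) (he : ∀ i, π (e i) = Sum.inr i) (w : MvPolynomial (Fin 3) k) :
    ε (rename e w) = C (ι w) := by
  induction w using MvPolynomial.induction_on with
  | C c => rw [rename_C, hεC]
  | add p q hp hq => rw [map_add, map_add, hp, hq, map_add, map_add]
  | mul_X p i hp => rw [map_mul, rename_X, map_mul, hp, hεX, he, map_mul, map_mul]; rfl

/-! ## §2 The quotient bridge for a chart `X₄² + X_a · rename e w` -/

/-- **The quotient bridge `k[X]/(G) ≃+* Λ[T]/(h)`** (`G = X₄² + X_a·rename e w`, `h = T₀² + T₁·C(ι w)`) carrying the centre `(X₄, X_a, rename e w)` onto `(T₀, T₁, C(ι w))` generator by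
generator, for a splitting with `π 4 = inl 0`, `π a = inl 1`, `π ∘ e = inr`. [plumbing] -/
theorem exists_quotientEquiv_chart (k : Type) [Field k] {Λ : Type} [CommRing Λ] (ι : MvPolynomial (Fin 3) k ≃+* Λ) (π : Fin 5 ≃ Fin 2 ⊕ Fin 3) (a : Fin 5)
    (h4 : π 4 = Sum.inl 0) (ha : π a = Sum.inl 1) (e : Fin 3 → Fin 5) (he : ∀ i, π (e i) = Sum.inr i) (w : MvPolynomial (Fin 3) k)
    (G : MvPolynomial (Fin 5) k) (hG : G = X 4 ^ 2 + X a * rename e w)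
    (c : Fin 3 → MvPolynomial (Fin 5) k) (hc : c = ![X 4, X a, rename e w])
    (J : Ideal (MvPolynomial (Fin 5) k ⧸ Ideal.span {G})) (hJ : J = (Ideal.span (Set.range c)).map (Ideal.Quotient.mk (Ideal.span {G})))
    (g : Λ) (hg : g = ι w) (cen : Fin 3 → MvPolynomial (Fin 2) Λ) (hcen : cen = ![X 0, X 1, C g])
    (h : MvPolynomial (Fin 2) Λ) (hh : h = X 0 ^ 2 + X 1 * C g) :
    ∃ εq : (MvPolynomial (Fin 5) k ⧸ Ideal.span {G}) ≃+* (MvPolynomial (Fin 2) Λ ⧸ Ideal.span {h}),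
      (∀ q, εq (Ideal.Quotient.mk (Ideal.span {G}) (c q)) = Ideal.Quotient.mk (Ideal.span {h}) (cen q)) ∧
        Ideal.map εq J = (Ideal.span (Set.range cen)).map (Ideal.Quotient.mk (Ideal.span {h})) := by
  obtain ⟨ε, hεX, hεC⟩ := exists_ringEquiv_fin5_of_perm k ι π
  have e4 : ε (X 4) = X 0 := by rw [hεX, h4]; rfl
  have ea : ε (X a) = X 1 := by rw [hεX, ha]; rfl
  have ew : ε (rename e w) = C g := by rw [hg]; exact apply_rename_eq_C k ι π ε hεX hεC e he w
  have hεg : ε G = h := by rw [hG, hh, map_add, map_pow, map_mul, e4, ea, ew]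
  have hεc : ∀ q, ε (c q) = cen q := by
    intro q
    subst hc hcen
    fin_cases q
    · exact e4
    · exact ea
    · exact ew
  have hmap : Ideal.span {h} = (Ideal.span {G}).map (ε : MvPolynomial (Fin 5) k →+* MvPolynomial (Fin 2) Λ) := by
    rw [Ideal.map_span, Set.image_singleton]
    exact congrArg _ (congrArg _ hεg.symm)
  let εq := Ideal.quotientEquiv (Ideal.span {G}) (Ideal.span {h}) ε hmap
  have hεq : ∀ x, εq (Ideal.Quotient.mk (Ideal.span {G}) x) = Ideal.Quotient.mk (Ideal.span {h}) (ε x) := fun x =>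
    Ideal.quotientEquiv_mk _ _ _ _ x
  refine ⟨εq, fun q => by rw [hεq, hεc], ?_⟩
  have hcomp : (εq : _ →+* _).comp (Ideal.Quotient.mk (Ideal.span {G})) =
      (Ideal.Quotient.mk (Ideal.span {h})).comp (ε : MvPolynomial (Fin 5) k →+* MvPolynomial (Fin 2) Λ) :=
    RingHom.ext fun x => hεq x
  have hfun : ((ε : MvPolynomial (Fin 5) k →+* MvPolynomial (Fin 2) Λ) ∘ c : Fin 3 → _) = cen :=
    funext fun q => by rw [Function.comp_apply, RingEquiv.coe_toRingHom]; exact hεc q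
  have key : Ideal.map (εq : _ →+* _) J = (Ideal.span (Set.range cen)).map (Ideal.Quotient.mk (Ideal.span {h})) := by
    rw [hJ, Ideal.map_map, hcomp, ← Ideal.map_map, Ideal.map_span, ← Set.range_comp, hfun]
  exact key

/-! ## §3 The chart package: regular blow-up, `Sing = V(J)`, prime centre -/

/-- ★★ **THE CHART PACKAGE.** `w ∈ k[Y₀,Y₁,Y₂]` prime with smooth zero locus (`∀` prime `Q ∋ w` `∃ D`, `D w ∉ Q`), chart ring `C_a = k[X]/(G)`, `G = X₄² + X_a·rename e w`, centre
`J = (X₄, X_a, rename e w)·C_a` (any `a ≠ 4`, any splitting `π` with `π 4 = inl 0`, `π a = inl 1`, `π ∘ e = inr`): the chart rings `C_a[J/x̄_a]`, `C_a[J/w̄]` are REGULAR,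
`Sing(Spec C_a) = V(J)`, `J` is PRIME, and `x̄₄² = −x̄_a·w̄` (the reduction relation). ANY field, ANY characteristic. [folklore; cite: Liu2002, Thm. 8.1.19 (a); StacksProject, Tag 07PF] -/
theorem chart_package (k : Type) [Field k] (π : Fin 5 ≃ Fin 2 ⊕ Fin 3) (a : Fin 5) (h4 : π 4 = Sum.inl 0) (ha : π a = Sum.inl 1)
    (e : Fin 3 → Fin 5) (he : ∀ i, π (e i) = Sum.inr i) (w : MvPolynomial (Fin 3) k) (hw : Prime w)
    (hws : ∀ Q : Ideal (MvPolynomial (Fin 3) k), Q.IsPrime → w ∈ Q → ∃ D : Derivation k (MvPolynomial (Fin 3) k) (MvPolynomial (Fin 3) k), D w ∉ Q)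
    (G : MvPolynomial (Fin 5) k) (hG : G = X 4 ^ 2 + X a * rename e w)
    (c : Fin 3 → MvPolynomial (Fin 5) k) (hc : c = ![X 4, X a, rename e w])
    (J : Ideal (MvPolynomial (Fin 5) k ⧸ Ideal.span {G})) (hJ : J = (Ideal.span (Set.range c)).map (Ideal.Quotient.mk (Ideal.span {G}))) :
    (IsRegularRing (blowupAlgebra J (Ideal.Quotient.mk (Ideal.span {G}) (c 1))) ∧
        IsRegularRing (blowupAlgebra J (Ideal.Quotient.mk (Ideal.span {G}) (c 2)))) ∧
      (∀ (P : Ideal (MvPolynomial (Fin 5) k ⧸ Ideal.span {G})) [P.IsPrime], ¬ IsRegularLocalRing (Localization.AtPrime P) ↔ J ≤ P) ∧ J.IsPrime ∧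
      Ideal.Quotient.mk (Ideal.span {G}) (c 0) ^ 2 = -(Ideal.Quotient.mk (Ideal.span {G}) (c 1) * Ideal.Quotient.mk (Ideal.span {G}) (c 2)) := by
  haveI : (Ideal.span {w}).IsPrime := (Ideal.span_singleton_prime hw.ne_zero).mpr hw
  haveI : IsDomain (MvPolynomial (Fin 3) k ⧸ Ideal.span {w}) := Ideal.Quotient.isDomain _
  have hg0 : IsSMulRegular (MvPolynomial (Fin 3) k) w := ODPCurveCentre.isSMulRegular_of_ne_zero _ hw.ne_zero
  obtain ⟨εq, hεq, hJ'⟩ := exists_quotientEquiv_chart k (RingEquiv.refl _) π a h4 ha e he w G hG c hc J hJ w rfl _ rfl _ rfl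
  have hreg := X2YGBlowupRegularLocal.isRegularRing_blowupAlgebra_strictTransform w _ _ hg0 hws rfl rfl _ rfl
  have hsing := fun (P : Ideal (MvPolynomial (Fin 2) (MvPolynomial (Fin 3) k) ⧸ Ideal.span {(X 0 ^ 2 + X 1 * C w : MvPolynomial (Fin 2) (MvPolynomial (Fin 3) k))}))
    (hP : P.IsPrime) => X2YGBlowupRegularLocal.not_isRegularLocalRing_iff_map_le w _ _ hw.ne_zero hws rfl rfl P
  have hprime := X2YGBlowupRegular.isPrime_map_span_cen w (![X 0, X 1, C w] : Fin 3 → MvPolynomial (Fin 2) (MvPolynomial (Fin 3) k)) _ rfl rfl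
  have hrel := X2YGCentre.mk_cen_zero_sq w (![X 0, X 1, C w] : Fin 3 → MvPolynomial (Fin 2) (MvPolynomial (Fin 3) k)) _ rfl rfl
  exact X2Cubic4FloorTwoCharts.transport_of_quotientEquiv₃ εq _ _ hεq J _ hJ' hreg (fun P hP => hsing P hP) hprime hrel

/-- ★★ **`Bl_J Spec C_a` IS A REGULAR SCHEME** under the hypotheses of `chart_package` (the two regular chart rings and the reduction relation, by
`X2YGBlowupRegular.isRegular_affineBlowup_of_sq_eq_neg_mul`). [folklore; cite: Liu2002, Thm. 8.1.19 (a); GortzWedhorn2020, Prop. 13.91 (4)] -/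
theorem isRegular_affineBlowup_chart (k : Type) [Field k] (π : Fin 5 ≃ Fin 2 ⊕ Fin 3) (a : Fin 5) (h4 : π 4 = Sum.inl 0) (ha : π a = Sum.inl 1)
    (e : Fin 3 → Fin 5) (he : ∀ i, π (e i) = Sum.inr i) (w : MvPolynomial (Fin 3) k) (hw : Prime w)
    (hws : ∀ Q : Ideal (MvPolynomial (Fin 3) k), Q.IsPrime → w ∈ Q → ∃ D : Derivation k (MvPolynomial (Fin 3) k) (MvPolynomial (Fin 3) k), D w ∉ Q)
    (G : MvPolynomial (Fin 5) k) (hG : G = X 4 ^ 2 + X a * rename e w)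
    (c : Fin 3 → MvPolynomial (Fin 5) k) (hc : c = ![X 4, X a, rename e w])
    (J : Ideal (MvPolynomial (Fin 5) k ⧸ Ideal.span {G})) (hJ : J = (Ideal.span (Set.range c)).map (Ideal.Quotient.mk (Ideal.span {G}))) :
    Scheme.IsRegular (affineBlowup J) := by
  obtain ⟨⟨r1, r2⟩, -, -, hrel⟩ := chart_package k π a h4 ha e he w hw hws G hG c hc J hJ
  refine X2YGBlowupRegular.isRegular_affineBlowup_of_sq_eq_neg_mul J (fun l => Ideal.Quotient.mk (Ideal.span {G}) (c l)) ?_ hrel r1 r2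
  rw [hJ, Ideal.map_span, ← Set.range_comp]
  rfl

end Summit.ResolutionOfSingularities.ResolutionOfSingularities.Theorems.FInjectiveMacaulayfication.X2CubicFormChart

end
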